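import Mathlib
import Literature.Combinatorics.Additive.TripleProductProperty

/-!
# `SingleAutomatonRigidity`, line `Sketch` — stub `stub_zeroSumCard` (diagonal zero-sums)

Route `MatrixMultiplication/AutomaticSTPPDesigns`, crux `stmt-MatrixMultiplication-7359`
(`Summit.MatrixMultiplication.MatrixMultiplication.Theses.AutomaticSTPPDesigns.SingleAutomatonRigidity`),
line `Sketch`, stub `stub_zeroSumCard`.

For an STPP family `(Aᵢ, Bᵢ, Cᵢ)ᵢ` in an additive abelian group `H` put
`D = ⋃ᵢ (Aᵢ - Bᵢ)`, `E = ⋃ᵢ (Bᵢ - Cᵢ)`, `F = ⋃ᵢ (Cᵢ - Aᵢ)` (block-difference sets). Every zero-sum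
triple `(d, e, f) ∈ D × E × F`, `d + e + f = 0`, is *diagonal*: writing `d = a - b`, `e = b' - x`,
`f = x' - a'` the relation `(a - a') + (b' - b) + (x' - x) = 0` and the one-clause form of the STPP
(`Literature.Combinatorics.Additive.addSimultaneousTPP_iff_forall`) force the three block indices to
agree and `a = a'`, `b = b'`, `x = x'`. Hence the zero-sum triples (encoded as `g : Fin 3 → H` in
`Fintype.piFinset ![D, E, F]` with `∑ j, g j = 0`) inject into `Σ i, Aᵢ × Bᵢ × Cᵢ`, and their number
is at most `∑ᵢ |Aᵢ| |Bᵢ| |Cᵢ|` — the counting hypothesis of Green's arithmetic removal lemma in the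
line. Only Mathlib's finset API and the proved lemma `addSimultaneousTPP_iff_forall` are used.
-/

-- the tree's namespace `Summit.MatrixMultiplication.MatrixMultiplication.…` repeats a component by
-- design
set_option linter.dupNamespace false

namespace Summit.MatrixMultiplication.MatrixMultiplication.Theorems.SingleAutomatonRigidity

open Finset
open Literature.Combinatorics.Additive

/-- **Diagonal zero-sums** in the block-difference sets of an STPP family: with
`D = ⋃ᵢ (Aᵢ - Bᵢ)`, `E = ⋃ᵢ (Bᵢ - Cᵢ)`, `F = ⋃ᵢ (Cᵢ - Aᵢ)`, the number of `g ∈ D × E × F`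
(as `g : Fin 3 → H`) with `g 0 + g 1 + g 2 = 0` is at most `∑ᵢ |Aᵢ| |Bᵢ| |Cᵢ|`, because every such
`g` is `(a - b, b - c, c - a)` for one index `i` and one `(a, b, c) ∈ Aᵢ × Bᵢ × Cᵢ` (one-clause STPP
`addSimultaneousTPP_iff_forall` read backwards). -/
theorem stub_zeroSumCard {H : Type*} [AddCommGroup H] [DecidableEq H] {ι : Type*} [Fintype ι]
    (A B C : ι → Finset H) (hS : AddSimultaneousTPP A B C) :
    ((Fintype.piFinset ![univ.biUnion fun i => image₂ (· - ·) (A i) (B i),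
        univ.biUnion fun i => image₂ (· - ·) (B i) (C i),
        univ.biUnion fun i => image₂ (· - ·) (C i) (A i)]).filter fun g => ∑ j, g j = 0).card
      ≤ ∑ i, (A i).card * (B i).card * (C i).card := by
  rw [addSimultaneousTPP_iff_forall] at hS
  -- the diagonal parametrisation `(i, a, b, c) ↦ (a - b, b - c, c - a)`
  set f : (Σ _ : ι, H × H × H) → (Fin 3 → H) :=
    fun q => ![q.2.1 - q.2.2.1, q.2.2.1 - q.2.2.2, q.2.2.2 - q.2.1] with hf
  calc _ ≤ ((univ.sigma fun i => A i ×ˢ (B i ×ˢ C i)).image f).card := by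
        refine card_le_card fun g hg => ?_
        rw [mem_filter, Fintype.mem_piFinset] at hg
        obtain ⟨hg, hsum⟩ := hg
        have h0 := hg 0
        have h1 := hg 1
        have h2 := hg 2
        simp only [Matrix.cons_val_zero, Matrix.cons_val_one, Matrix.cons_val_two, Matrix.head_cons,
          Matrix.tail_cons, mem_biUnion, mem_univ, true_and, mem_image₂] at h0 h1 h2
        obtain ⟨i₁, a, ha, b, hb, hab⟩ := h0
        obtain ⟨i₂, b', hb', x, hx, hbx⟩ := h1
        obtain ⟨i₃, x', hx', a', ha', hxa⟩ := h2
        rw [Fin.sum_univ_three, ← hab, ← hbx, ← hxa] at hsum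
        have key : a - a' + (b' - b) + (x' - x) = 0 := by
          rw [← hsum]; abel
        obtain ⟨h12, h23, haa, hbb, hxx⟩ :=
          hS i₁ i₂ i₃ a' ha' a ha b hb b' hb' x hx x' hx' key
        -- `h12 : i₁ = i₂`, `h23 : i₂ = i₃`, `haa : a' = a`, `hbb : b = b'`, `hxx : x = x'`
        rw [← hbb] at hbx
        rw [← hxx, haa] at hxa
        rw [← h12] at hx
        refine mem_image.mpr ⟨⟨i₁, a, b, x⟩, ?_, ?_⟩
        · simp [ha, hb, hx]
        · funext j
          fin_cases j
          · simpa [hf] using hab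
          · simpa [hf] using hbx
          · simpa [hf] using hxa
    _ ≤ (univ.sigma fun i => A i ×ˢ (B i ×ˢ C i)).card := card_image_le
    _ = ∑ i, (A i).card * (B i).card * (C i).card := by
        rw [card_sigma]
        simp only [card_product, mul_assoc]

end Summit.MatrixMultiplication.MatrixMultiplication.Theorems.SingleAutomatonRigidity
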